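import Literature.NumberTheory.LFunctions.LiCoefficientArithmeticFormula
import Literature.NumberTheory.LFunctions.KeiperLiTrend
import Literature.NumberTheory.LFunctions.BombieriLagariasEtaLimit
import HarnessLib

/-!
# RH-FREE: discharge of `Lagarias2007_thm51_zeta` and `Coffey2005_thm2` (the trend of Li's coefficients)

Topic `Literature/NumberTheory/LFunctions`; proofs file for two of the three named facts of
`LiCoefficientArithmeticFormula.lean` (the vocabulary of record of the RH-criterion column LI:
`liArchSum = S₁`, `liArchPart = S_∞`, `liTrend = λ̄`, `liC1 = C₁`), from the trend law of
`KeiperLiTrend.lean`.  Everything here is PROVED; no definitions; **RH-FREE** (no hypothesis on zeros).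

* `keiperLiCoeff_sub_osc_eq_liTrend` — the dictionary: `λ_n − S_n = liTrend n` (`n ≥ 1`), where
  `S_n = Σ_{j<n} C(n,j+1) Re q_j` is the oscillating part in the `q`-form of `KeiperLiTrend.lean`
  (`q_j = (ζ₁'/ζ₁)^{(j)}(1)/j!`); this is `keiperLiCoeff_sub_osc_eq_finite_sum` read in the new vocabulary.
* `Lagarias2007_thm51_zeta_holds` — **Lagarias 2007, Thm. 5.1 for `ζ`**: `|S_∞(n) − (½ n log n + C₁ n)| ≤ A`
  for all `n ≥ 1`, here with the explicit `A = 1/2 + 2/π` (from `keiperLiTrend_log_bounds`).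
* `Coffey2005_thm2_holds` — **Coffey 2005, Thm. 2 (20) and Corollary**: for `n ≥ 2`,
  `(n/2) ln n + (γ−1)n/2 + 1/2 ≤ S₁(n) ≤ (n/2) ln n + (γ+1)n/2 − 1/2`.  For `n ≥ 4` the trend law
  (`|λ̄_n − ((n/2)(H_n − 1 − log 2π) + 1/2)| ≤ 2/π` with `log n + γ ≤ H_n ≤ log n + γ + 1/n`) leaves a
  margin `(n/2)(γ + log 2) − 1 ≥ 2/π`, resp. `(n/2)(2 − γ − log 2) − 1/2 ≥ 2/π`; `n = 3` uses `H_3 = 11/6`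
  and `1 < log 3 < 2 log 2`; `n = 2` is `S₁(2) = ¾ ζ(2) = π²/8` (Mathlib's `riemannZeta_two`, `3 < π < 3.15`).

* `abs_liTrend_sub_harmonic_le`, `abs_liTrend_sub_harmonic_pred_le`, `abs_liTrend_sub_harmonic_le_div`,
  `tendsto_liTrend_sub_harmonic` — the trend law of `KeiperLiTrend.lean` read for Maślanka's `λ̄_n = liTrend n`
  itself (no `λ_n`, no `q_j`): `|λ̄_n − ((n/2)(H_n − 1 − log 2π) + 1/2)| ≤ 2/π`, the `H_{n−1}` shape
  `|λ̄_n − (1 + (n/2)(H_{n−1} − 1 − log 2π))| ≤ 2/π`, the decay `≤ (640/π³)/(n−1)`, and the limit `1/2`.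
* `Coffey2005_thm1_limits_exist` — the first clause of `Coffey2005_thm1`: for every `k` the limit defining
  `η_k` exists (`BombieriLagariasEtaLimit.tendsto_sum_vonMangoldt_log_pow_div_sub_exists`).

The third fact, `Coffey2005_thm1` (existence of the `x → ∞` limits defining `η_k` and
`λ_n = λ̄_n + λ̃_n` with `λ̃_n = −Σ C(n,m) η_{m−1}`), is NOT fully discharged here: its first clause is `Coffey2005_thm1_limits_exist`; the identification of the
limits (`η_k = −Re q_k`, whence `λ_n = λ̄_n + λ̃_n`) needs an Abelian comparison with
`ZetaLogDerivTaylorPrimes.tendsto_LSeries_vonMangoldt_logPow_sub` — left open.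

## References

* [Lagarias2007LiCoefficients] J. C. Lagarias, *Li coefficients for automorphic L-functions*, Ann. Inst.
  Fourier 57 (2007) 1689–1740, Thm. 5.1, (5.4).
* [Coffey2005LiCriterion] M. W. Coffey, *Toward verification of the Riemann hypothesis: application of the
  Li criterion*, Math. Phys. Anal. Geom. 8 (2005) 211–255, Thm. 2 (eq. (20)) and Corollary.
* [Maslanka2004LiCoefficients] K. Maślanka, arXiv:math/0402168 (2004), §2.
* [Voros2006] A. Voros, Math. Phys. Anal. Geom. 9 (2006), §4 (4.6) (the trend law used).
-/

noncomputable section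


namespace Literature.NumberTheory.LFunctions

open Finset

/-- **Dictionary**: the trend of `KeiperLiTrend.lean` is Maślanka's `λ̄_n` of
`LiCoefficientArithmeticFormula.lean`: `λ_n − S_n = liTrend n = 1 + S_∞(n)` (`n ≥ 1`).
[cite: Maslanka2004LiCoefficients, §2] -/
theorem keiperLiCoeff_sub_osc_eq_liTrend {n : ℕ} (hn : 1 ≤ n) :
    keiperLiCoeff n - ∑ j ∈ Finset.range n, (n.choose (j + 1) : ℝ) *
        (Xiao2020.zetaOneLogDerivCoeff j).re = liTrend n := by
  rw [keiperLiCoeff_sub_osc_eq_finite_sum hn, liTrend_eq, liArchPart_eq, liArchSum]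
  have h : ∀ j : ℕ, (1 - 1 / (2 : ℝ) ^ j) = (1 - (2 : ℝ)⁻¹ ^ j) := fun j ↦ by rw [inv_pow, one_div]
  simp_rw [h]
  ring

/-- **Discharge of `Lagarias2007_thm51_zeta`** (Lagarias 2007, Thm. 5.1 for `ζ`: `S_∞(n) = ½ n log n + C₁ n
+ O(1)` unconditionally), with the explicit constant `A = 1/2 + 2/π`, from the trend law
`keiperLiTrend_log_bounds` of `KeiperLiTrend.lean`. RH-FREE. [cite: Lagarias2007LiCoefficients, Thm. 5.1 and eq. (5.4)] -/
theorem Lagarias2007_thm51_zeta_holds : Lagarias2007_thm51_zeta := by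
  refine ⟨1 / 2 + 2 / Real.pi, fun n hn ↦ ?_⟩
  have h := keiperLiTrend_log_bounds hn
  rw [keiperLiCoeff_sub_osc_eq_liTrend hn, liTrend_eq] at h
  have e : (n : ℝ) / 2 * (Real.log n + Real.eulerMascheroniConstant - 1 - Real.log (2 * Real.pi)) =
      n / 2 * Real.log n + liC1 * n := by rw [liC1]; ring
  rw [e] at h
  rw [abs_le]
  constructor <;> linarith [h.1, h.2]

/-- `Re ζ(2) = π²/6`. [folklore] -/
private theorem re_riemannZeta_two : (riemannZeta 2).re = Real.pi ^ 2 / 6 := by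
  rw [riemannZeta_two]
  rw [show (Real.pi : ℂ) ^ 2 / 6 = ((Real.pi ^ 2 / 6 : ℝ) : ℂ) by push_cast; ring, Complex.ofReal_re]

/-- `H_3 = 11/6`. [folklore] -/
private theorem harmonic_three : (harmonic 3 : ℝ) = 11 / 6 := by
  have : harmonic 3 = 11 / 6 := by
    rw [show (3 : ℕ) = 0 + 1 + 1 + 1 by rfl, harmonic_succ, harmonic_succ, harmonic_succ, harmonic_zero]
    norm_num
  rw [this]; norm_num

/-- Coffey's `S₁(n)` through the trend: `S₁(n) = (λ_n − S_n) − 1 + (n/2)(γ + log π + 2 log 2)`. [folklore] -/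
private theorem liArchSum_eq_trend (n : ℕ) (hn : 1 ≤ n) :
    liArchSum n = (keiperLiCoeff n - ∑ j ∈ Finset.range n, (n.choose (j + 1) : ℝ) *
        (Xiao2020.zetaOneLogDerivCoeff j).re) - 1 +
      (n : ℝ) / 2 * (Real.eulerMascheroniConstant + Real.log Real.pi + 2 * Real.log 2) := by
  rw [keiperLiCoeff_sub_osc_eq_liTrend hn, liTrend_eq, liArchPart_eq]; ring

/-- **Discharge of `Coffey2005_thm2`** (Coffey 2005, Thm. 2 (20) and its Corollary): for `n ≥ 2`,
`(n/2) ln n + (γ−1)n/2 + 1/2 ≤ S₁(n) ≤ (n/2) ln n + (γ+1)n/2 − 1/2`. From the trend law of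
`KeiperLiTrend.lean` (`|λ̄_n − ((n/2)(H_n − 1 − log 2π) + 1/2)| ≤ 2/π`, `log n + γ ≤ H_n ≤ log n + γ + 1/n`),
which leaves a margin linear in `n` that absorbs `2/π` for `n ≥ 4`; `n = 3` with `H_3 = 11/6`,
`1 < log 3 < 2 log 2`; `n = 2` directly, `S₁(2) = ¾ζ(2) = π²/8`. RH-FREE.
[cite: Coffey2005LiCriterion, Thm. 2 (eq. (20)) and Corollary] -/
theorem Coffey2005_thm2_holds : Coffey2005_thm2 := by
  intro n hn
  have hγ1 := Real.one_half_lt_eulerMascheroniConstant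
  have hγ2 := Real.eulerMascheroniConstant_lt_two_thirds
  have hl2a := Real.log_two_gt_d9
  have hl2b := Real.log_two_lt_d9
  have hπ3 := Real.pi_gt_three
  have hπ0 := Real.pi_pos
  have h2π : 2 / Real.pi < 2 / 3 := by
    rw [div_lt_div_iff₀ hπ0 (by norm_num : (0 : ℝ) < 3)]; linarith
  have h2π0 : 0 < 2 / Real.pi := by positivity
  rcases Nat.lt_or_ge n 4 with hlt | hge
  · interval_cases n
    · -- n = 2
      rw [liArchSum_two, re_riemannZeta_two]
      have hπb := Real.pi_lt_d2
      simp only [Nat.cast_ofNat]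
      constructor <;> nlinarith
    · -- n = 3
      have ht := abs_le.1 (abs_keiperLiCoeff_sub_osc_sub_trend_le (n := 3) (by norm_num))
      rw [liArchSum_eq_trend 3 (by norm_num)]
      rw [harmonic_three] at ht
      have hl3a : 1 < Real.log 3 := by
        rw [Real.lt_log_iff_exp_lt (by norm_num : (0 : ℝ) < 3)]
        have := Real.exp_one_lt_d9; linarith
      have hl3b : Real.log 3 < 2 * Real.log 2 := by
        rw [show (2 : ℝ) * Real.log 2 = Real.log (2 ^ 2) by rw [Real.log_pow]; norm_num]
        exact Real.log_lt_log (by norm_num) (by norm_num)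
      have hl2π : Real.log (2 * Real.pi) = Real.log 2 + Real.log Real.pi :=
        Real.log_mul two_ne_zero Real.pi_ne_zero
      rw [hl2π] at ht
      simp only [Nat.cast_ofNat] at ht ⊢
      constructor <;> nlinarith [ht.1, ht.2]
  · have hn1 : 1 ≤ n := by omega
    have h := keiperLiTrend_log_bounds hn1
    rw [liArchSum_eq_trend n hn1]
    have hl2π : Real.log (2 * Real.pi) = Real.log 2 + Real.log Real.pi :=
      Real.log_mul two_ne_zero Real.pi_ne_zero
    rw [hl2π] at h
    have hn4 : (4 : ℝ) ≤ n := by exact_mod_cast hge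
    set T := keiperLiCoeff n - ∑ j ∈ Finset.range n, (n.choose (j + 1) : ℝ) *
        (Xiao2020.zetaOneLogDerivCoeff j).re with hT
    have hA : 0 < Real.eulerMascheroniConstant + Real.log 2 := by linarith
    have hB : 0 < 2 - Real.eulerMascheroniConstant - Real.log 2 := by linarith
    have hA' : 4 / 2 * (Real.eulerMascheroniConstant + Real.log 2) ≤
        (n : ℝ) / 2 * (Real.eulerMascheroniConstant + Real.log 2) :=
      mul_le_mul_of_nonneg_right (by linarith) hA.le
    have hB' : 4 / 2 * (2 - Real.eulerMascheroniConstant - Real.log 2) ≤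
        (n : ℝ) / 2 * (2 - Real.eulerMascheroniConstant - Real.log 2) :=
      mul_le_mul_of_nonneg_right (by linarith) hB.le
    constructor
    · nlinarith [h.1]
    · nlinarith [h.2]

end Literature.NumberTheory.LFunctions

namespace Literature.NumberTheory.LFunctions

open Filter Topology

/-- **RH-FREE trend law for Maślanka's `λ̄_n`** (Voros 2006, (4.6)), in the vocabulary of record:
for `n ≥ 1`, `|λ̄_n − ((n/2)(H_n − 1 − log 2π) + 1/2)| ≤ 2/π`, `λ̄_n = liTrend n` the explicit finite
expression `1 − (n/2)(γ + log 4π) + Σ_{j=2}^{n} (−1)ʲ C(n,j)(1 − 2^{−j}) ζ(j)`. [cite: Voros2006, §4 eq. (4.6)] -/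
theorem abs_liTrend_sub_harmonic_le {n : ℕ} (hn : 1 ≤ n) :
    |liTrend n - (n / 2 * ((harmonic n : ℝ) - 1 - Real.log (2 * Real.pi)) + 1 / 2)| ≤ 2 / Real.pi := by
  rw [← keiperLiCoeff_sub_osc_eq_liTrend hn]
  exact abs_keiperLiCoeff_sub_osc_sub_trend_le hn

/-- The same with `H_{n−1}` (`(n/2)H_{n−1} = (n/2)H_n − 1/2`): for `n ≥ 1`,
`|λ̄_n − (1 + (n/2)(H_{n−1} − 1 − log 2π))| ≤ 2/π` — the shape `λ̄_n ≈ 1 + (n/2)(ψ(n) + γ − 1 − log 2π)`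
of Voros's (4.5)–(4.6). [cite: Voros2006, §4 eqs. (4.5)–(4.6)] -/
theorem abs_liTrend_sub_harmonic_pred_le {n : ℕ} (hn : 1 ≤ n) :
    |liTrend n - (1 + n / 2 * ((harmonic (n - 1) : ℝ) - 1 - Real.log (2 * Real.pi)))| ≤ 2 / Real.pi := by
  have h := abs_liTrend_sub_harmonic_le hn
  obtain ⟨m, rfl⟩ : ∃ m, n = m + 1 := ⟨n - 1, by omega⟩
  simp only [Nat.add_sub_cancel]
  have hH : ((harmonic (m + 1) : ℚ) : ℝ) = (harmonic m : ℝ) + 1 / ((m : ℝ) + 1) := by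
    rw [harmonic_succ]; push_cast; ring
  rw [hH] at h
  have e : ((m + 1 : ℕ) : ℝ) / 2 * ((harmonic m : ℝ) + 1 / ((m : ℝ) + 1) - 1 - Real.log (2 * Real.pi)) + 1 / 2 =
      1 + ((m + 1 : ℕ) : ℝ) / 2 * ((harmonic m : ℝ) - 1 - Real.log (2 * Real.pi)) := by
    push_cast; field_simp; ring
  rwa [e] at h

/-- **RH-FREE decay**: for `n ≥ 2`, `|λ̄_n − ((n/2)(H_n − 1 − log 2π) + 1/2)| ≤ (640/π³)/(n − 1)`.
[cite: Voros2006, §4 eq. (4.6)] -/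
theorem abs_liTrend_sub_harmonic_le_div {n : ℕ} (hn : 2 ≤ n) :
    |liTrend n - (n / 2 * ((harmonic n : ℝ) - 1 - Real.log (2 * Real.pi)) + 1 / 2)| ≤
      640 / Real.pi ^ 3 / (n - 1 : ℝ) := by
  rw [← keiperLiCoeff_sub_osc_eq_liTrend (by omega)]
  exact abs_keiperLiCoeff_sub_osc_sub_trend_le_div hn

/-- **RH-FREE. The constant term of Maślanka's trend**: `λ̄_n − (n/2)(H_n − 1 − log 2π) → 1/2`
(Voros's `3/4` in the `log n` form, as `(n/2)(H_n − log n − γ) → 1/4`). [cite: Voros2006, §4 eq. (4.6)] -/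
theorem tendsto_liTrend_sub_harmonic :
    Tendsto (fun n : ℕ ↦ liTrend n - n / 2 * ((harmonic n : ℝ) - 1 - Real.log (2 * Real.pi)))
      atTop (𝓝 (1 / 2)) := by
  refine tendsto_keiperLiCoeff_sub_osc_sub_trend.congr' ?_
  filter_upwards [Filter.eventually_ge_atTop 1] with n hn
  rw [← keiperLiCoeff_sub_osc_eq_liTrend hn]

end Literature.NumberTheory.LFunctions

namespace Literature.NumberTheory.LFunctions

open Filter Topology

/-- **The limits defining `η_k` exist** — the first clause of `Coffey2005_thm1` (Bombieri–Lagarias Thm. 2;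
Coffey 2005 (11)): for every `k`, `liEtaSeq k N = Σ_{m≤N} Λ(m)(log m)^k/m − (log N)^{k+1}/(k+1)` converges.
This is `tendsto_sum_vonMangoldt_log_pow_div_sub_exists` of `BombieriLagariasEtaLimit.lean`. RH-FREE.
[cite: Coffey2005LiCriterion, Thm. 1, eq. (11)] -/
theorem Coffey2005_thm1_limits_exist (k : ℕ) : ∃ L : ℝ, Tendsto (liEtaSeq k) atTop (𝓝 L) := by
  obtain ⟨L, hL⟩ := tendsto_sum_vonMangoldt_log_pow_div_sub_exists k
  exact ⟨L, hL.congr fun N ↦ by simp only [liEtaSeq]⟩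

end Literature.NumberTheory.LFunctions
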